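import Mathlib
import Summits.PneNP.PneNP.Theorems.Nc03AvoidResidualCoreReductionBfsP1

/-!
# Route Nc03AvoidResidualCore, item `ResidualCoreReduction` — the solver, X: BFS as a program, parents and forest

Helper file for `stmt-PneNP-20227` (sequel of `…ReductionBfsP1`; cell pnp-ideate). List-level
counterparts of the second half of the BFS vocabulary (`…ReductionBfsB`): the edge entry lookup
`entryP`, the other endpoint `otherP`, the least parent edge `peP`, `parentP`, ancestors `ancP`,
the deeper endpoint `deepP`, and the BFS forest as a bit string `forestP`; each agrees with the
`Bip` notion on genuine data (`otherP_eq`, `peP_eq`, `parentP_eq`, `ancP_eq`, `deepP_eq`,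
`forestP_rep`) and is polynomial time (`codeFP_…`).
-/

set_option linter.dupNamespace false -- `Summit.PneNP.PneNP.…`: summit = sub-problem name (D-0017 single-conjunct layout)

namespace Summit.PneNP.PneNP.Theorems.Nc03Reduction

open Literature.Computability.Complexity CodeFP

/-! ## Programs -/

/-- The entry of edge `j` (junk `(0,0,0)` if absent). -/
def entryP (gd : GD) (j : ℕ) : ℕ × ℕ × ℕ := (gd.2.find? fun t => decide (t.1 = j)).getD (0, 0, 0)

/-- The other endpoint of an entry. -/
def otherE (t : ℕ × ℕ × ℕ) (w : ℕ) : ℕ := if decide (w = t.2.1) then t.2.2 else t.2.1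

/-- The other endpoint of edge `j`. -/
def otherP (gd : GD) (j w : ℕ) : ℕ := otherE (entryP gd j) w

/-- The parent-edge test on an edge index. -/
def peTest (gd : GD) (E : List Bool) (w j : ℕ) : Bool :=
  E.getD j false && (decide (w = (entryP gd j).2.1) || decide (w = (entryP gd j).2.2)) &&
    decide (depthP gd E (otherE (entryP gd j) w) + 1 = depthP gd E w)

/-- The least parent edge of `w` (junk `0` if none). -/
def peP (gd : GD) (E : List Bool) (w : ℕ) : ℕ :=
  ((List.range gd.2.length).find? fun j => peTest gd E w j).getD 0

/-- The parent of `w`. -/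
def parentP (gd : GD) (E : List Bool) (w : ℕ) : ℕ := otherP gd (peP gd E w) w

/-- The `k`-th ancestor of `w`. -/
def ancP (gd : GD) (E : List Bool) (k w : ℕ) : ℕ := (parentP gd E)^[k] w

/-- The deeper endpoint of edge `j`. -/
def deepP (gd : GD) (E : List Bool) (j : ℕ) : ℕ :=
  if decide (depthP gd E (entryP gd j).2.1 < depthP gd E (entryP gd j).2.2) then (entryP gd j).2.2
  else (entryP gd j).2.1

/-- Membership of edge `j` in the BFS forest. -/
def inForestP (gd : GD) (E : List Bool) (j : ℕ) : Bool :=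
  decide (0 < depthP gd E (deepP gd E j)) && decide (peP gd E (deepP gd E j) = j)

/-- The BFS forest as a bit string over edge indices. -/
def forestP (gd : GD) (E : List Bool) : List Bool := (List.range gd.2.length).map fun j => inForestP gd E j

/-! ## Agreement with `Bip` -/

section Bridge

variable {M K : ℕ} {G : Bip (Fin M) (Fin K)} {S : Finset (Fin M)} {E : List Bool}

/-- The number of edge entries. -/
@[simp] theorem length_gdOf : (gdOf G).2.length = M := by simp [gdOf]

/-- **Entries**: the program finds the genuine entry. -/
theorem entryP_eq (j : Fin M) : entryP (gdOf G) j.val = (j.val, (G.eA j).val, (G.eB j).val) := by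
  unfold entryP gdOf
  simp only
  have h : (List.ofFn fun j : Fin M => (j.val, (G.eA j).val, (G.eB j).val)).find? (fun t => decide (t.1 = j.val)) =
      some (j.val, (G.eA j).val, (G.eB j).val) := by
    rw [List.find?_eq_some_iff_getElem]
    refine ⟨by simp, j.val, by simp, by rw [List.getElem_ofFn], fun i hi => ?_⟩
    rw [List.getElem_ofFn]
    simp only [Bool.not_eq_true', decide_eq_false_iff_not]
    exact Nat.ne_of_lt hi
  rw [h]; rfl

/-- **Other endpoints**: agreement with `Bip.other`. -/
theorem otherP_eq (j : Fin M) (w : Fin K) : otherP (gdOf G) j.val w.val = (G.other j w).val := by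
  unfold otherP otherE Bip.other
  rw [entryP_eq]
  simp only [Fin.ext_iff, decide_eq_true_eq]
  split_ifs <;> rfl

/-- The other endpoint of a genuine entry. -/
theorem otherE_entry (j : Fin M) (w : Fin K) :
    otherE (j.val, (G.eA j).val, (G.eB j).val) w.val = (G.other j w).val := by
  rw [← entryP_eq]; exact otherP_eq j w

/-- Unfolding one ancestor step. -/
theorem ancP_succ (gd : GD) (E : List Bool) (k w : ℕ) : ancP gd E (k + 1) w = parentP gd E (ancP gd E k w) := by
  unfold ancP; rw [Function.iterate_succ_apply']

/-- **Deeper endpoints**: agreement with `Bip.deep`. -/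
theorem deepP_eq (hE : RepE S E) (j : Fin M) : deepP (gdOf G) E j.val = (G.deep S j).val := by
  unfold deepP Bip.deep
  rw [entryP_eq]
  simp only
  rw [depthP_eq hE, depthP_eq hE]
  simp only [decide_eq_true_eq]
  split_ifs <;> rfl

/-- Reading the parent-edge test: membership in `peSet`. -/
theorem peTest_iff (hE : RepE S E) (w : Fin K) (j : Fin M) :
    peTest (gdOf G) E w.val j.val = true ↔ j ∈ G.peSet S w := by
  unfold peTest
  rw [entryP_eq]
  simp only
  rw [otherE_entry, depthP_eq hE, depthP_eq hE, hE j, Bip.peSet, Finset.mem_filter, G.mem_ends]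
  simp only [Bool.and_eq_true, Bool.or_eq_true, decide_eq_true_eq, Fin.ext_iff]
  rw [and_assoc]

variable [NeZero M]

/-- **Parent edges**: agreement with `Bip.pe`. -/
theorem peP_eq (hE : RepE S E) (w : Fin K) : peP (gdOf G) E w.val = (G.pe S w).val := by
  unfold peP
  rw [length_gdOf]
  by_cases h : (G.peSet S w).Nonempty
  · have hpe : G.pe S w = (G.peSet S w).min' h := by unfold Bip.pe; rw [dif_pos h]
    have hmem : G.pe S w ∈ G.peSet S w := by rw [hpe]; exact Finset.min'_mem _ _
    rw [find?_range_eq_some (p := fun j => peTest (gdOf G) E w.val j) (m := (G.pe S w).val) (G.pe S w).isLt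
      ((peTest_iff hE w _).2 hmem) fun i hi => ?_]
    · rfl
    · cases hc : peTest (gdOf G) E w.val i
      · rfl
      · exfalso
        have hi' : i < M := lt_trans hi (G.pe S w).isLt
        have hmem' := (peTest_iff hE w ⟨i, hi'⟩).1 hc
        have hle := Finset.min'_le _ _ hmem'
        rw [← hpe, Fin.le_def] at hle
        exact absurd hle (by simp only; omega)
  · have hpe : G.pe S w = default := by unfold Bip.pe; rw [dif_neg h]
    rw [hpe, Fin.default_eq_zero, Fin.val_zero, List.find?_eq_none.2]
    · rfl
    · intro j hj hc
      rw [List.mem_range] at hj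
      exact h ⟨⟨j, hj⟩, (peTest_iff hE w ⟨j, hj⟩).1 hc⟩

/-- **Parents**: agreement with `Bip.parent`. -/
theorem parentP_eq (hE : RepE S E) (w : Fin K) : parentP (gdOf G) E w.val = (G.parent S w).val := by
  unfold parentP Bip.parent
  rw [peP_eq hE, otherP_eq]

/-- **Ancestors**: agreement with `Bip.anc`. -/
theorem ancP_eq (hE : RepE S E) (k : ℕ) (w : Fin K) : ancP (gdOf G) E k w.val = (G.anc S k w).val := by
  induction k with
  | zero => rfl
  | succ k ih => rw [ancP_succ, ih, parentP_eq hE, Bip.anc_succ]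

/-- **Forest membership**: agreement with `Bip.forest`. -/
theorem inForestP_iff (hE : RepE S E) (j : Fin M) : inForestP (gdOf G) E j.val = true ↔ j ∈ G.forest S := by
  unfold inForestP
  rw [deepP_eq hE, depthP_eq hE, peP_eq hE, Bool.and_eq_true, decide_eq_true_eq, decide_eq_true_eq,
    ← Fin.ext_iff]
  constructor
  · rintro ⟨hpos, hpe⟩; rw [← hpe]; exact G.pe_mem_forest hpos
  · exact G.forest_eq_pe_deep

/-- **The forest bit string represents the forest.** -/
theorem forestP_rep (hE : RepE S E) : RepE (G.forest S) (forestP (gdOf G) E) := by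
  intro j
  unfold forestP
  rw [List.getD_eq_getElem?_getD, List.getElem?_map, List.getElem?_range (by rw [length_gdOf]; exact j.isLt)]
  simp only [Option.map_some, Option.getD_some]
  rw [Bool.eq_iff_iff, inForestP_iff hE, decide_eq_true_eq]

end Bridge

/-! ## Polynomial time -/

/-- The entry lookup is polynomial time. -/
theorem codeFP_entryP : CodeFP (pairE gdE natE) tripE (fun q => entryP q.1 q.2) := by
  have hp : CodeFP (pairE natE tripE) bitE (fun y => decide (y.2.1 = y.1)) := codeFP_eqTest (snd _ _).fst' (fst _ _)
  have hl : CodeFP (pairE gdE natE) (rawE tripE) (fun q => q.1.2) := (fst _ _).snd'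
  have hf : CodeFP (pairE gdE natE) (optE tripE) (fun q => q.1.2.find? fun t => decide (t.1 = q.2)) :=
    ((rawFind? hp).comp ((snd _ _).pair hl)).congr fun _ => rfl
  exact ((optGetD tripE).comp (hf.pair (const _ ((0 : ℕ), (0 : ℕ), (0 : ℕ))))).congr fun _ => rfl

/-- The other endpoint of an entry is polynomial time. -/
theorem codeFP_otherE : CodeFP (pairE tripE natE) natE (fun q => otherE q.1 q.2) :=
  (CodeFP.ite (codeFP_eqTest (snd _ _) (fst _ _).snd'.fst') (fst _ _).snd'.snd' (fst _ _).snd'.fst').congr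
    fun _ => rfl

/-- The parent-edge test is polynomial time. -/
theorem codeFP_peTest : CodeFP (pairE ceE (pairE natE natE)) bitE (fun q => peTest q.1.1 q.1.2 q.2.1 q.2.2) := by
  have hent : CodeFP (pairE ceE (pairE natE natE)) tripE (fun q => entryP q.1.1 q.2.2) :=
    (codeFP_entryP.comp ((fst _ _).fst'.pair (snd _ _).snd')).congr fun _ => rfl
  have hw : CodeFP (pairE ceE (pairE natE natE)) natE (fun q => q.2.1) := (snd _ _).fst'
  have hoth : CodeFP (pairE ceE (pairE natE natE)) natE (fun q => otherE (entryP q.1.1 q.2.2) q.2.1) :=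
    (codeFP_otherE.comp (hent.pair hw)).congr fun _ => rfl
  have hd1 : CodeFP (pairE ceE (pairE natE natE)) natE
      (fun q => depthP q.1.1 q.1.2 (otherE (entryP q.1.1 q.2.2) q.2.1)) :=
    (codeFP_depthP.comp ((fst _ _).pair hoth)).congr fun _ => rfl
  have hd2 : CodeFP (pairE ceE (pairE natE natE)) natE (fun q => depthP q.1.1 q.1.2 q.2.1) :=
    (codeFP_depthP.comp ((fst _ _).pair hw)).congr fun _ => rfl
  have hE : CodeFP (pairE ceE (pairE natE natE)) bitE (fun q => q.1.2.getD q.2.2 false) :=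
    (strGetDNat.comp ((fst _ _).snd'.pair (snd _ _).snd')).congr fun _ => rfl
  have hsucc : CodeFP (pairE ceE (pairE natE natE)) natE
      (fun q => depthP q.1.1 q.1.2 (otherE (entryP q.1.1 q.2.2) q.2.1) + 1) :=
    (natAdd.comp (hd1.pair (const _ 1))).congr fun _ => rfl
  exact ((hE.and ((codeFP_eqTest hw hent.snd'.fst').or (codeFP_eqTest hw hent.snd'.snd'))).and
    (codeFP_eqTest hsucc hd2)).congr fun _ => rfl

/-- The parent edge is polynomial time. -/
theorem codeFP_peP : CodeFP (pairE ceE natE) natE (fun q => peP q.1.1 q.1.2 q.2) := by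
  have hp : CodeFP (pairE (pairE ceE natE) natE) bitE (fun y => peTest y.1.1.1 y.1.1.2 y.1.2 y.2) :=
    (codeFP_peTest.comp ((fst _ _).fst'.pair ((fst _ _).snd'.pair (snd _ _)))).congr fun _ => rfl
  have hM : CodeFP (pairE ceE natE) unE (fun q => q.1.1.2.length) :=
    ((ulength tripE).comp (fst _ _).fst'.snd').congr fun _ => rfl
  have hf : CodeFP (pairE ceE natE) (optE natE) (fun q => (List.range q.1.1.2.length).find? fun j => peTest q.1.1 q.1.2 q.2 j) :=
    ((rawFind? hp).comp ((CodeFP.id _).pair (urange.comp hM))).congr fun _ => rfl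
  exact ((optGetD natE).comp (hf.pair (const _ 0))).congr fun _ => rfl

/-- The parent is polynomial time. -/
theorem codeFP_parentP : CodeFP (pairE ceE natE) natE (fun q => parentP q.1.1 q.1.2 q.2) := by
  have hent : CodeFP (pairE ceE natE) tripE (fun q => entryP q.1.1 (peP q.1.1 q.1.2 q.2)) :=
    (codeFP_entryP.comp ((fst _ _).fst'.pair codeFP_peP)).congr fun _ => rfl
  exact (codeFP_otherE.comp (hent.pair (snd _ _))).congr fun _ => rfl

/-- Components of the entry found (or the junk entry) are short. -/
theorem length_otherE_entryP_le (gd : GD) (j w : ℕ) : (natE (otherE (entryP gd j) w)).length ≤ (gdE gd).length := by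
  unfold entryP
  cases h : gd.2.find? (fun t => decide (t.1 = j)) with
  | none =>
    have h0 : natE 0 = [] := by decide
    simp [otherE, h0]
  | some t =>
    have hmem := List.mem_of_find?_eq_some h
    have h1 := length_item_le_length_rawE tripE hmem
    have h2 : (gdE gd).length ≥ (rawE tripE gd.2).length := by
      unfold gdE; rw [pairE_apply, length_boolPair]; omega
    have h3 : (natE t.2.1).length ≤ (tripE t).length ∧ (natE t.2.2).length ≤ (tripE t).length := by
      simp only [tripE, pairE_apply, length_boolPair]; omega
    simp only [Option.getD_some, otherE]
    split <;> omega

/-- **Ancestors are polynomial time** (height in unary). -/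
theorem codeFP_ancP : CodeFP (pairE ceE (pairE unE natE)) natE (fun q => ancP q.1.1 q.1.2 q.2.1 q.2.2) := by
  have hF : CodeFP (pairE (pairE ceE (pairE unE natE)) natE) natE (fun t => parentP t.1.1.1 t.1.1.2 t.2) :=
    (codeFP_parentP.comp ((fst _ _).fst'.pair (snd _ _))).congr fun _ => rfl
  have h := iterateInv (σ := (GD × List Bool) × ℕ × ℕ) (β := ℕ) (eσ := pairE ceE (pairE unE natE)) (eβ := natE)
    (F := fun s v => parentP s.1.1 s.1.2 v) (init := fun s => s.2.2) (k := fun s => s.2.1)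
    (fun s _ v => (natE v).length ≤ (pairE ceE (pairE unE natE) s).length)
    hF (snd _ _).snd' (snd _ _).fst'
    (fun s => by simp only [pairE_apply, length_boolPair]; omega)
    (fun s _ v _ => by
      unfold parentP otherP
      refine (length_otherE_entryP_le _ _ _).trans ?_
      simp only [pairE_apply, length_boolPair]; omega)
    Polynomial.X (fun s j v hv => by rw [Polynomial.eval_X]; exact hv.trans (Nat.le_add_right _ _))
  exact h.congr fun _ => rfl

/-- The deeper endpoint is polynomial time. -/
theorem codeFP_deepP : CodeFP (pairE ceE natE) natE (fun q => deepP q.1.1 q.1.2 q.2) := by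
  have hent : CodeFP (pairE ceE natE) tripE (fun q => entryP q.1.1 q.2) :=
    (codeFP_entryP.comp ((fst _ _).fst'.pair (snd _ _))).congr fun _ => rfl
  have hdA : CodeFP (pairE ceE natE) natE (fun q => depthP q.1.1 q.1.2 (entryP q.1.1 q.2).2.1) :=
    (codeFP_depthP.comp ((fst _ _).pair hent.snd'.fst')).congr fun _ => rfl
  have hdB : CodeFP (pairE ceE natE) natE (fun q => depthP q.1.1 q.1.2 (entryP q.1.1 q.2).2.2) :=
    (codeFP_depthP.comp ((fst _ _).pair hent.snd'.snd')).congr fun _ => rfl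
  have hlt : CodeFP (pairE ceE natE) bitE
      (fun q => decide (depthP q.1.1 q.1.2 (entryP q.1.1 q.2).2.1 < depthP q.1.1 q.1.2 (entryP q.1.1 q.2).2.2)) :=
    (natLt.comp (hdA.pair hdB)).congr fun _ => rfl
  exact (CodeFP.ite hlt hent.snd'.snd' hent.snd'.fst').congr fun _ => rfl

/-- Forest membership is polynomial time. -/
theorem codeFP_inForestP : CodeFP (pairE ceE natE) bitE (fun q => inForestP q.1.1 q.1.2 q.2) := by
  have hdd : CodeFP (pairE ceE natE) natE (fun q => depthP q.1.1 q.1.2 (deepP q.1.1 q.1.2 q.2)) :=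
    (codeFP_depthP.comp ((fst _ _).pair codeFP_deepP)).congr fun _ => rfl
  have hpd : CodeFP (pairE ceE natE) natE (fun q => peP q.1.1 q.1.2 (deepP q.1.1 q.1.2 q.2)) :=
    (codeFP_peP.comp ((fst _ _).pair codeFP_deepP)).congr fun _ => rfl
  have hpos : CodeFP (pairE ceE natE) bitE (fun q => decide (0 < depthP q.1.1 q.1.2 (deepP q.1.1 q.1.2 q.2))) :=
    (natLt.comp ((const _ 0).pair hdd)).congr fun _ => rfl
  exact (hpos.and (codeFP_eqTest hpd (snd _ _))).congr fun _ => rfl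

/-- The forest bit string is polynomial time. -/
theorem codeFP_forestP : CodeFP ceE strE (fun q => forestP q.1 q.2) := by
  have hM : CodeFP ceE unE (fun q => q.1.2.length) := ((ulength tripE).comp (fst _ _).snd').congr fun _ => rfl
  exact (bitsToStr.comp ((map codeFP_inForestP).comp ((CodeFP.id _).pair (urange.comp hM)))).congr fun _ => rfl

end Summit.PneNP.PneNP.Theorems.Nc03Reduction
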